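import Summits.AtomisticToContinuum.Crystallization.Theses.PhononSlackCertificates
import Summits.AtomisticToContinuum.Crystallization.Theorems.ChargedEnergyGap.Negative.Unconditional
import Summits.AtomisticToContinuum.Crystallization.Theorems.PhononSlackCertificatesCoerciveTwoShellGapSepReduction
import Summits.AtomisticToContinuum.Crystallization.Theorems.PhononSlackCertificatesCoerciveTwoShellGapPeriodisation

/-!
# Disproof of `CoerciveTwoShellGap` (stmt-AtomisticToContinuum-13956) — findings of the crux disprover

Crux (route `PhononSlackCertificates`, rank 0 / target, auto-cruxed):

  `∀ δ > 0, ∃ g > 0, ∀ N (x : Fin N → ℝ³), x δ-separated →`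
  `N·e* + g·#{i : ¬ IsTwoShellGood (1/20) (47/50) 1 x i} ≤ 𝓔_LJ(x)`,   `e* = ⨅_Q e_LJ(Q)`.

**VERDICT (cycle 1): NO KILL.**  The statement as typed is sane (no junk value enters, see §1) and
every cheap physical attack pays a positive price per bad particle; what is left is a quantitative
Lennard-Jones crystallization lower bound (BlancLewin2015 §2.3, open in `d = 3`).  This file records,
as kernel-checked theorems, which parts of the statement are load-bearing, how tight the shape is,
which strengthenings are false, and what a refutation would have to certify.  Provers: cite freely;
the conclusive lemmas are also proposed under `Theorems/CoerciveTwoShellGap/Negative/`.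

## Index of findings

* §1 READ-BACK / JUNK AUDIT (docstring below): `e*` is a genuine infimum (`BddBelow` proved in tree,
  `tsum` summable in `d = 3`), `e* ≤ −1/24` (`eStar_le_neg_one_div`); single counting on both sides;
  both two-shell patterns checked by hand against the Barlow geometry (every Barlow stacking is
  exactly good; a perfect close packing of nearest-neighbour distance `d` is `1/20`-good iff
  `d ∈ [0.9068, 1.0354]`, which contains `a* ≈ 0.9712`).
* §2 THE SKELETON IS FREE, THE QUANTIFIER PREFIX IS EMPTY: `N·e* ≤ 𝓔(x)` for every injective `x`
  (tree, `card_mul_eStar_le`); the crux is EQUIVALENT to its single instance `δ = 1/3`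
  (`coerciveTwoShellGap_iff_third`, via the landed `stub_sepReduction`), follows from the
  `δ`-free injective form (`coerciveTwoShellGap_of_injectiveForm`) and from the two-shell gap on
  the TORUS (`coerciveTwoShellGap_of_torusGap`, landed stubs 1–2 composed).  So `g` may be taken
  uniform in `δ`; the separation hypothesis is used only through injectivity and the `1/3`-floor.
* §3 LOAD-BEARING — SEPARATION/INJECTIVITY: with the separation hypothesis dropped the statement is
  FALSE for every `g` (`coerciveTwoShellGap_false_without_sep`: the pile-up `k×0, k×e₀` has energy
  `−k²/12` because `V_LJ(0) = 0` in Lean); equivalently the hypothesis `0 < δ` cannot be weakened to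
  `0 ≤ δ` (`coerciveTwoShellGap_false_at_delta_zero`).  A junk-model effect, not physics.
* §4 LOAD-BEARING — THE TOLERANCE `1/20 > 0`: with tolerance `ε ≤ 0` in place of `1/20` the crux is
  FALSE (`not_coerciveTwoShellGapTol_of_nonpos`): Lennard-Jones ground states are `δ₀`-separated
  (tree facts `LennardJonesGroundStatesExist_holds`, `LennardJonesMinimalDistance_holds`), have
  `E(N)/N → e*` (`crysEnergyLimit`), and an explicit generic perturbation `xᵢ + t·4ⁱ·e₀` with
  `t < δ₀/(2·4ᴺ)` keeps `δ₀/2`-separation, costs `→ 0` energy and makes EVERY particle exactly-bad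
  (an exact match needs two equidistant neighbours).  The set of tolerances for which the crux holds
  is an up-set (`CoerciveTwoShellGapTol.mono`); it misses `(−∞, 0]`; the crux claims `1/20 ∈` it.  The
  true threshold `ε_c ∈ (0, ?]` is the misfit of the relaxed optimal polytype (planner: relaxed hcp
  `c/a` off ideal by `1e-4–1e-3`, uncertified) — any proof must use `ε = 1/20` QUANTITATIVELY.
* §5 TIGHTNESS OF `g`: every admissible `g` (at any `δ ≤ 1`) has `g ≤ −1/24 − e*` (dimer) and
  `g ≤ −e*` (one particle) (`g_le_of_gapAt`, `g_le_neg_eStar_of_gapAt`).  Certified tightness stops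
  here because the tree has no lower bound on `e*` sharper than stability constants.  NUMERICS
  (uncertified, Cruxes/…/BarrierNotesIdeator2.md §B1, NumericsIdeator1.md): the binding population is
  the RATTLER — one atom of a good matrix displaced by just over `a/20` flips itself and its 18
  pattern neighbours at relaxed cost `≈ 0.035`, so `g_opt ≈ 1.8–2.5e-3 ≈ |e*|/400`; homogeneous
  threshold strain costs `≥ 1.68·(1/20)² = 4.2e-3` per (bad) particle; vacancy `≈ |e*|/18 = 0.04`;
  bcc/sc/expanded/compressed lattices `≥ 2e-2`; LJ₁₃ icosahedron `0.43`; free gas `|e*|`.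
* §6 STRENGTHENINGS REFUTED / NOT: (i) tolerance `→ 0`: false (§4).  (ii) POINTWISE version (each bad
  particle's half site energy `≥ e* + g`): this is the route's own `FarFieldGap` with `U = {i}`,
  refuted-misstated 2026-08-15/16 (dense `δ`-cloud around one bad particle; `ledger negatives`), not
  re-proved here (a Lean proof needs a lower bound on `e*`).  (iii) `g` independent of `δ`: NOT a
  strengthening (§2, equivalent).  (iv) window/patterns: stacking-blind by construction (§1).
* §7 LINE `Sketch` (lead prover-line-…-13956-0; stubs `stub_sepReduction` LANDED p96828,
  `stub_periodisation` p97286, `stub_torusSlice` (S, `le_csSup`), `stub_torusQMC` (the core)):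
  joint sufficiency is kernel-checked (`CoerciveTwoShellGap_of` in Lines/Sketch.lean); no stub is
  cheaply refutable: the §4 mechanism (generic perturbation) is exactly what the FLOOR `θₗ = 1/50` of
  `stub_torusQMC` defuses (misfit below `1/50` is free), and the §3 mechanism is excluded by the
  `1/3`-separation of `P.points`; the floor-free variant (`θₗ = 0`) is plausibly FALSE (relaxed hcp has
  positive misfit at zero excess) but uncertifiable here for the same reason as `ε_c`.  See §7 below.
* §8 WHAT A REFUTATION MUST CERTIFY (`violation_squeeze`): a witness `x` at `(δ, g)` is a
  near-minimiser, `0 ≤ 𝓔(x) − N·e* < g·#bad ≤ g·N`; certifying it in Lean needs `e*` FROM BELOW to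
  precision `g·#bad/N` — a Kepler-type lower bound on all periodic LJ energies sharp to `~1e-3·|e*|`
  if the witness is physical.  None exists in the tree (`KeplerBound` is open); this is why the crux
  resists disproof as much as proof.

All theorems below are sorry-free; axioms ⊆ {propext, Classical.choice, Quot.sound}.
LANDED under `Theorems/CoerciveTwoShellGap/Negative/` (namespace `…Theorems.CoerciveTwoShellGapNegative`,
definition-free spellings of §§3–5, §8): `Tolerance.lean` — p99369 ACCEPTED (`not_tol_of_nonpos`,
`tol_mono`, `exists_pert_small`, `dist_pert_ge`, `not_isTwoShellGood_of_nonpos_of_distinct`,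
`not_isTwoShellGood_of_le`, `bad_*`); `Shape.lean` — p102427 ACCEPTED (`skeleton`,
`iInf_le_neg_one_div`, `coerciveTwoShellGap_false_without_sep`, `coerciveTwoShellGap_false_at_delta_zero`,
`g_le_neg_iInf_of_gap`, `g_le_of_gap`, `violation_squeeze`, `not_coerciveTwoShellGap_iff`).
-/

noncomputable section

namespace Summit.AtomisticToContinuum.Crystallization.Cruxes.CoerciveTwoShellGap.Disproof

open scoped BigOperators Classical
open Literature.MathematicalPhysics.StatisticalMechanics Literature.Geometry.DiscreteGeometry
open Summit.AtomisticToContinuum.Crystallization.Theorems.ChargedEnergyGapNegative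
open Summit.AtomisticToContinuum.Crystallization.Theses.PhononSlackCertificates

/-! ## §1 Read-back and junk audit (prose)

* `interactionEnergy V x = ∑ i, ∑ j ∈ Ioi i, V (dist (x i) (x j))` — single counting;
  `energyPerParticle = (2·#motif)⁻¹ ∑_{x ∈ motif} ∑'_{y ∈ points, y ≠ x} V` — single counting too.
* `e* = eStar = ⨅ Q, Q.energyPerParticle lennardJones`: `BddBelow` is
  `bddBelow_energyPerParticle_lennardJones` (tree), so `ciInf_le` is available (`eStar_le`); the inner
  `tsum` is summable for every periodic `Q` in `d = 3` (`summable_lennardJones_dist_three`).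
* `Nat.card {i // ¬ good}` is a finite cardinal `≤ N` (`bad_le`).
* `IsTwoShellGood ε aLo aHi x i`: scale `a ∈ [aLo, aHi]`, linear isometry `A` (O(3)), pattern
  `P ∈ {fcc, hcp}` (18 points, norms `1`/`√2`, checked against `hcpInt`: upper layer
  `{(3,3,0),(3,0,3),(0,3,3),(6,0,0),(0,6,0),(0,0,6)}/√18`, lower layer its mirror in `x+y+z=0`),
  assignment `f` injective on `P`, `dist (x (f v)) (x i + a•A v) ≤ ε a`, covering every `j ≠ i` with
  `dist (x j) (x i) ≤ 3a/2`.  The centre is PINNED at `x i` (no translation), which is what makes a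
  displaced atom bad (§5 rattler).  Within `3a/2` of a site of ANY Barlow stacking lie exactly its own
  layer's hexagon and `3 + 3` points of each adjacent layer, i.e. the fcc or the hcp pattern according
  as the two adjacent layers differ or agree: stacking-blindness is exact, as the planner intends.
-/

/-- The number of `ε`-bad particles of a finite configuration (window `[47/50, 1]`). -/
def bad (ε : ℝ) {N : ℕ} (x : Fin N → E3) : ℕ :=
  Nat.card {i : Fin N // ¬ IsTwoShellGood ε (47 / 50) 1 x i}

/-- `#bad ≤ N`. [folklore] -/
theorem bad_le (ε : ℝ) {N : ℕ} (x : Fin N → E3) : bad ε x ≤ N := by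
  unfold bad
  exact (Finite.card_subtype_le _).trans_eq (Nat.card_fin N)

/-- If nobody is good, `#bad = N`. [folklore] -/
theorem bad_eq_of_forall (ε : ℝ) {N : ℕ} {x : Fin N → E3}
    (h : ∀ i : Fin N, ¬ IsTwoShellGood ε (47 / 50) 1 x i) : bad ε x = N := by
  unfold bad
  rw [Nat.card_congr (Equiv.subtypeUnivEquiv h), Nat.card_eq_fintype_card, Fintype.card_fin]

/-- Badness is antitone in the tolerance: `#bad ε' ≤ #bad ε` for `ε ≤ ε'`. [folklore] -/
theorem bad_anti {ε ε' : ℝ} (hε : ε ≤ ε') {N : ℕ} (x : Fin N → E3) : bad ε' x ≤ bad ε x := by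
  unfold bad
  exact Nat.card_mono (Set.toFinite _) fun i hi hg => hi (hg.mono hε (by norm_num))

/-- **With at most `18` particles nobody is good** (a goodness witness assigns the `18` pattern
points injectively to particles other than the centre). [folklore] -/
theorem not_isTwoShellGood_of_le {ε aLo aHi : ℝ} {N : ℕ} (hN : N ≤ 18) (x : Fin N → E3)
    (i : Fin N) : ¬ IsTwoShellGood ε aLo aHi x i := by
  rintro ⟨a, -, -, A, P, f, hP, hf, hinj, -⟩
  have hcard : P.card = 18 := card_eq_eighteen_of_twoShellPattern hP
  have himg : P.image f ⊆ Finset.univ.erase i := by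
    intro j hj
    obtain ⟨v, hv, rfl⟩ := Finset.mem_image.1 hj
    exact Finset.mem_erase.2 ⟨(hf v hv).1, Finset.mem_univ _⟩
  have h1 : (P.image f).card = 18 := by rw [Finset.card_image_of_injOn hinj, hcard]
  have h2 : (Finset.univ.erase i).card = N - 1 := by
    rw [Finset.card_erase_of_mem (Finset.mem_univ i), Finset.card_univ, Fintype.card_fin]
  have := Finset.card_le_card himg
  omega

/-- Hence small configurations are all-bad. [folklore] -/
theorem bad_eq_of_le (ε : ℝ) {N : ℕ} (hN : N ≤ 18) (x : Fin N → E3) : bad ε x = N :=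
  bad_eq_of_forall ε fun i => not_isTwoShellGood_of_le hN x i

/-- **`e* ≤ −1/24 < 0`** unconditionally: the periodised dimer has energy per particle
`≤ E(dimer)/2 = −1/24` (cross-cell terms are `≤ 0`). [folklore] -/
theorem eStar_le_neg_one_div : eStar ≤ -1 / 24 := by
  have h1 := eStar_le (periodise dimer (periodUnit dimer) le_rfl (by norm_num : 0 < 2))
  have h2 := energyPerParticle_periodise_le dimer_injective (periodUnit dimer) le_rfl
    (by norm_num : 0 < 2)
  rw [interactionEnergy_dimer] at h2
  have := h1.trans h2
  norm_num at this
  linarith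

/-! ## §2 The skeleton is free; the quantifier prefix `∀ δ ∃ g` carries nothing -/

/-- The crux's inequality at a given separation `δ` and price `g` (the matrix of the crux). -/
def GapAt (δ g : ℝ) : Prop :=
  ∀ (N : ℕ) (x : Fin N → E3), (∀ i j : Fin N, i ≠ j → δ ≤ dist (x i) (x j)) →
    (N : ℝ) * eStar + g * (bad (1 / 20) x : ℝ) ≤ interactionEnergy lennardJones x

/-- The crux is `∀ δ > 0, ∃ g > 0, GapAt δ g` (definitional unfolding). [folklore] -/
theorem coerciveTwoShellGap_iff : CoerciveTwoShellGap ↔ ∀ δ : ℝ, 0 < δ → ∃ g : ℝ, 0 < g ∧ GapAt δ g :=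
  Iff.rfl

/-- `δ`-separated configurations (`δ > 0`) are injective. [folklore] -/
theorem injective_of_sep {δ : ℝ} (hδ : 0 < δ) {N : ℕ} {x : Fin N → E3}
    (h : ∀ i j : Fin N, i ≠ j → δ ≤ dist (x i) (x j)) : Function.Injective x := by
  intro i j hij
  by_contra hne
  have := h i j hne
  rw [hij, dist_self] at this
  linarith

/-- **The `g = 0` skeleton is free**: `N·e* ≤ 𝓔(x)` for every `δ`-separated `x`, `δ > 0`
(tree: periodisation + `BddBelow`).  All content of the crux is `0 < g`. [folklore] -/
theorem gapAt_zero {δ : ℝ} (hδ : 0 < δ) : GapAt δ 0 := by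
  intro N x hx
  have := card_mul_eStar_le (injective_of_sep hδ hx)
  simpa using this

/-- `GapAt` is monotone in `δ` and antitone in `g`. [folklore] -/
theorem GapAt.mono {δ δ' g g' : ℝ} (hδ : δ ≤ δ') (hg : g' ≤ g) (h : GapAt δ g) : GapAt δ' g' := by
  intro N x hx
  have h1 := h N x fun i j hij => hδ.trans (hx i j hij)
  have h0 : (0 : ℝ) ≤ (bad (1 / 20) x : ℝ) := Nat.cast_nonneg _
  nlinarith

/-- **The crux is equivalent to its single instance `δ = 1/3`** (`→`: instantiate; `←`: the landed
`stub_sepReduction`, closest-pair deletion with `g' = min g (−e*/83)`).  So the `∀ δ ∃ g` prefix is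
cosmetic: one inequality for `1/3`-separated configurations is the whole crux. [folklore] -/
theorem coerciveTwoShellGap_iff_third : CoerciveTwoShellGap ↔ ∃ g : ℝ, 0 < g ∧ GapAt (1 / 3) g := by
  constructor
  · intro h
    exact h (1 / 3) (by norm_num)
  · rintro ⟨g, hg, hG⟩
    exact Theorems.CoerciveTwoShellGapSepReduction.stub_sepReduction ⟨g, hg, hG⟩

/-- **The crux follows from the two-shell gap ON THE TORUS** (landed stubs `stub_periodisation`
p97286 and `stub_sepReduction` p96828 composed): one `g > 0` such that every periodic configuration
with `1/3`-separated point set pays `g` per `1/20`-bad motif point (badness read in `P.points`).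
With the lead's `stub_torusSlice` this reduces the crux to `stub_torusQMC` alone. [folklore] -/
theorem coerciveTwoShellGap_of_torusGap
    (h : ∃ g : ℝ, 0 < g ∧ ∀ P : PeriodicConfiguration 3,
      (∀ u ∈ P.points, ∀ v ∈ P.points, u ≠ v → (1 / 3 : ℝ) ≤ dist u v) →
        (⨅ Q : PeriodicConfiguration 3, Q.energyPerParticle lennardJones)
          + g * ((P.motif.filter fun y => ¬ IsTwoShellGoodSet (1 / 20) (47 / 50) 1 P.points y).card : ℝ)
              / (P.motif.card : ℝ)
          ≤ P.energyPerParticle lennardJones) :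
    CoerciveTwoShellGap :=
  Theorems.CoerciveTwoShellGapSepReduction.stub_sepReduction
    (Theorems.CoerciveTwoShellGapPeriodisation.stub_periodisation h)

/-- **The `δ`-free injective form implies the crux** (with the same `g` for every `δ`).  (The
converse — crux ⇒ injective form with `g' = min g(1/3) (−e*/83)` — is the internal `main` step of the
landed `stub_sepReduction`.) [folklore] -/
theorem coerciveTwoShellGap_of_injectiveForm
    (h : ∃ g : ℝ, 0 < g ∧ ∀ (N : ℕ) (x : Fin N → E3), Function.Injective x →
      (N : ℝ) * eStar + g * (bad (1 / 20) x : ℝ) ≤ interactionEnergy lennardJones x) :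
    CoerciveTwoShellGap := by
  obtain ⟨g, hg, hG⟩ := h
  exact fun δ hδ => ⟨g, hg, fun N x hx => hG N x (injective_of_sep hδ hx)⟩

/-! ## §3 Load-bearing: separation / injectivity (a junk-model effect, `V_LJ(0) = 0`) -/

/-- The crux with the separation hypothesis DROPPED (any `g`). -/
def CoerciveTwoShellGapWithoutSep : Prop :=
  ∃ g : ℝ, 0 < g ∧ ∀ (N : ℕ) (x : Fin N → E3),
    (N : ℝ) * eStar + g * (bad (1 / 20) x : ℝ) ≤ interactionEnergy lennardJones x

/-- **Without separation the crux is false**: the pile-up of `k` particles at `0` and `k` at `e₀`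
has `𝓔 = −k²/12` (coincident pairs contribute `V_LJ(0) = 0`), quadratic in `N = 2k`, against a
left side `≥ 2k·e*`.  Any proof must use the separation hypothesis — but only through injectivity
(§2). [folklore] -/
theorem coerciveTwoShellGap_false_without_sep : ¬ CoerciveTwoShellGapWithoutSep := by
  rintro ⟨g, hg, h⟩
  obtain ⟨k₀, hk₀⟩ := exists_nat_gt (24 * |eStar|)
  set k := k₀ + 1 with hk
  have hk' : 24 * |eStar| < k := by
    have : (k₀ : ℝ) ≤ k := by simp [hk]
    linarith
  have hgk := h (k + k) (pile k)
  rw [interactionEnergy_pile] at hgk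
  push_cast at hgk
  have hb0 : (0 : ℝ) ≤ (bad (1 / 20) (pile k) : ℝ) := Nat.cast_nonneg _
  have h3 : -(|eStar| * (k + k)) ≤ ((k : ℝ) + k) * eStar := by
    have := neg_abs_le (((k : ℝ) + k) * eStar)
    rw [abs_mul, abs_of_nonneg (by positivity : (0 : ℝ) ≤ k + k)] at this
    linarith
  have hkpos : (0 : ℝ) < k := by positivity
  have h4 : (k : ℝ) ^ 2 / 12 ≤ (k + k) * |eStar| := by nlinarith
  have h5 : (k : ℝ) ≤ 24 * |eStar| := by
    by_contra hlt
    push Not at hlt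
    have h6 : (k : ℝ) * (24 * |eStar|) < (k : ℝ) * k := mul_lt_mul_of_pos_left hlt hkpos
    rw [pow_two] at h4
    linarith
  linarith

/-- **Equivalently, `0 < δ` cannot be weakened to `0 ≤ δ`**: at `δ = 0` the separation hypothesis
is vacuous and the pile-up applies. [folklore] -/
theorem coerciveTwoShellGap_false_at_delta_zero :
    ¬ ∀ δ : ℝ, 0 ≤ δ → ∃ g : ℝ, 0 < g ∧ GapAt δ g := by
  intro h
  obtain ⟨g, hg, hG⟩ := h 0 le_rfl
  exact coerciveTwoShellGap_false_without_sep ⟨g, hg, fun N x => hG N x fun i j _ => dist_nonneg⟩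

/-! ## §4 Load-bearing: the tolerance (`1/20` cannot go to `0`) -/

/-- The crux with tolerance `ε` in place of `1/20` (so the crux is `CoerciveTwoShellGapTol (1/20)`). -/
def CoerciveTwoShellGapTol (ε : ℝ) : Prop :=
  ∀ δ : ℝ, 0 < δ → ∃ g : ℝ, 0 < g ∧ ∀ (N : ℕ) (x : Fin N → E3),
    (∀ i j : Fin N, i ≠ j → δ ≤ dist (x i) (x j)) →
      (N : ℝ) * eStar + g * (bad ε x : ℝ) ≤ interactionEnergy lennardJones x

/-- The crux is the `ε = 1/20` instance (definitionally). [folklore] -/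
theorem coerciveTwoShellGap_iff_tol : CoerciveTwoShellGap ↔ CoerciveTwoShellGapTol (1 / 20) :=
  Iff.rfl

/-- **Monotonicity**: the tolerances at which the crux holds form an up-set. [folklore] -/
theorem CoerciveTwoShellGapTol.mono {ε ε' : ℝ} (hε : ε ≤ ε') (h : CoerciveTwoShellGapTol ε) :
    CoerciveTwoShellGapTol ε' := by
  intro δ hδ
  obtain ⟨g, hg, hG⟩ := h δ hδ
  refine ⟨g, hg, fun N x hx => le_trans ?_ (hG N x hx)⟩
  have : (bad ε' x : ℝ) ≤ bad ε x := by exact_mod_cast bad_anti hε x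
  nlinarith

/-- **Exact goodness needs two equidistant neighbours**: at tolerance `ε ≤ 0` the match is exact,
`x (f v) = x i + a•A v`, so `dist (x i) (x (f v)) = a‖v‖`, and two of the `18` pattern points share
a norm (only the values `1`, `√2` occur); hence a particle whose distances to the other particles are
pairwise distinct is `ε`-bad. [folklore] -/
theorem not_isTwoShellGood_of_nonpos_of_distinct {ε aLo aHi : ℝ} (hε : ε ≤ 0) (haLo : 0 ≤ aLo)
    {N : ℕ} {x : Fin N → E3} {i : Fin N}
    (h : ∀ j k : Fin N, j ≠ i → k ≠ i → j ≠ k → dist (x i) (x j) ≠ dist (x i) (x k)) :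
    ¬ IsTwoShellGood ε aLo aHi x i := by
  rintro ⟨a, ha₁, -, A, P, f, hP, hf, hinj, -⟩
  have ha0 : 0 ≤ a := haLo.trans ha₁
  have hcard : P.card = 18 := card_eq_eighteen_of_twoShellPattern hP
  have hmaps : ∀ v ∈ P, ‖v‖ ∈ ({1, Real.sqrt 2} : Finset ℝ) := by
    intro v hv
    rcases hP with rfl | rfl
    · rcases norm_of_mem_fccTwoShellPattern hv with h | h <;> simp [h]
    · rcases norm_of_mem_hcpTwoShellPattern hv with h | h <;> simp [h]
  have hlt : ({1, Real.sqrt 2} : Finset ℝ).card < P.card := by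
    rw [hcard]; exact Finset.card_le_two.trans_lt (by norm_num)
  obtain ⟨v, hv, w, hw, hvw, heq⟩ := Finset.exists_ne_map_eq_of_card_lt_of_maps_to hlt hmaps
  have hexact : ∀ u ∈ P, dist (x i) (x (f u)) = a * ‖u‖ := by
    intro u hu
    have h1 : dist (x (f u)) (x i + a • A u) ≤ ε * a := (hf u hu).2
    have h2 : ε * a ≤ 0 := by nlinarith
    have h3 : x (f u) = x i + a • A u := dist_le_zero.1 (h1.trans h2)
    rw [h3, dist_eq_norm, sub_add_cancel_left, norm_neg, norm_smul, Real.norm_of_nonneg ha0,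
      A.norm_map]
  have hfv : f v ≠ f w := fun hh => hvw (hinj hv hw hh)
  exact h (f v) (f w) (hf v hv).1 (hf w hw).1 hfv (by rw [hexact v hv, hexact w hw, heq])

section Perturbation

variable {N : ℕ}

/-- Separation survives the tree's generic perturbation `yᵢ + t·4ⁱ·e₀`:
`dist − |t|·4ᴺ ≤ dist after`. [folklore] -/
theorem dist_pert_ge (y : Fin N → E3) (t : ℝ) (i j : Fin N) :
    dist (y i) (y j) - |t| * (4 : ℝ) ^ N ≤ dist (pert y t i) (pert y t j) := by
  have hw : ∀ k : Fin N, 0 ≤ wt k ∧ wt k ≤ (4 : ℝ) ^ N := fun k =>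
    ⟨by unfold wt; positivity, by
      unfold wt; exact pow_le_pow_right₀ (by norm_num) k.2.le⟩
  have hdiff : |wt i - wt j| ≤ (4 : ℝ) ^ N := by
    rw [abs_sub_le_iff]; constructor <;> linarith [hw i, hw j]
  rw [dist_eq_norm, dist_eq_norm, pert_sub]
  have h1 : ‖y i - y j‖ - ‖(t * (wt i - wt j)) • e0‖ ≤
      ‖(y i - y j) + (t * (wt i - wt j)) • e0‖ := by
    have := norm_sub_norm_le (y i - y j) (-((t * (wt i - wt j)) • e0))
    rw [norm_neg, sub_neg_eq_add] at this
    exact this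
  have h2 : ‖(t * (wt i - wt j)) • e0‖ ≤ |t| * (4 : ℝ) ^ N := by
    rw [norm_smul, norm_e0, mul_one, Real.norm_eq_abs, abs_mul]
    exact mul_le_mul_of_nonneg_left hdiff (abs_nonneg t)
  linarith

/-- The tree's `exists_pert` with the parameter additionally below a prescribed `τ > 0`: an
injective perturbation with pairwise distinct distances from each site, energy cost `< ε`,
`0 < t < τ`. [folklore] -/
theorem exists_pert_small (y : Fin N → E3) (hy : Function.Injective y) {ε τ : ℝ} (hε : 0 < ε)
    (hτ : 0 < τ) :
    ∃ t : ℝ, 0 < t ∧ t < τ ∧ Function.Injective (pert y t) ∧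
      (∀ i j k : Fin N, j ≠ i → k ≠ i → j ≠ k →
        dist (pert y t i) (pert y t j) ≠ dist (pert y t i) (pert y t k)) ∧
      interactionEnergy lennardJones (pert y t) < interactionEnergy lennardJones y + ε := by
  have hev : ∀ᶠ t in nhds (0 : ℝ),
      interactionEnergy lennardJones (pert y t) < interactionEnergy lennardJones y + ε :=
    (tendsto_energy_pert y hy).eventually (gt_mem_nhds (lt_add_of_pos_right _ hε))
  obtain ⟨r, hr, hball⟩ := Metric.eventually_nhds_iff.1 hev
  set B : Set ℝ :=
    (⋃ i : Fin N, ⋃ j : Fin N, ⋃ k : Fin N, {t : ℝ | j ≠ i ∧ k ≠ i ∧ j ≠ k ∧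
      dist (pert y t i) (pert y t j) = dist (pert y t i) (pert y t k)}) ∪
    ⋃ i : Fin N, ⋃ j : Fin N, {t : ℝ | i ≠ j ∧ pert y t i = pert y t j} with hB_def
  have hB : B.Finite :=
    (Set.finite_iUnion fun i => Set.finite_iUnion fun j => Set.finite_iUnion fun k =>
      finite_bad_triple y i j k).union
      (Set.finite_iUnion fun i => Set.finite_iUnion fun j => finite_bad_pair y i j)
  obtain ⟨t, ht, htB⟩ := ((Set.Ioo_infinite (lt_min hr hτ)).sdiff hB).nonempty
  have htr : t < r := ht.2.trans_le (min_le_left _ _)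
  refine ⟨t, ht.1, ht.2.trans_le (min_le_right _ _), ?_, ?_, hball ?_⟩
  · intro i j hij
    by_contra hne
    exact htB (Or.inr (Set.mem_iUnion.2 ⟨i, Set.mem_iUnion.2 ⟨j, hne, hij⟩⟩))
  · intro i j k hj hk hjk heq
    exact htB (Or.inl (Set.mem_iUnion.2 ⟨i, Set.mem_iUnion.2 ⟨j, Set.mem_iUnion.2
      ⟨k, hj, hk, hjk, heq⟩⟩⟩))
  · rw [Real.dist_eq, sub_zero, abs_of_pos ht.1]
    exact htr

end Perturbation

/-- **The tolerance is load-bearing**: with `ε ≤ 0` in place of `1/20` the crux is FALSE.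
Ground states are `δ₀`-separated and `E(N)/N → e*`; perturb a large one generically with
`t < δ₀/(2·4ᴺ)`: it stays `δ₀/2`-separated, its energy rises by `< N·g/2`, and every particle is
exactly-bad, so `N(e* + g) ≤ 𝓔 < N(e* + g)`.  (The crux asks the inequality at `δ = δ₀/2`; the
refutation therefore bites whatever `g(δ₀/2)` is offered.) [folklore] -/
theorem not_coerciveTwoShellGapTol_of_nonpos {ε : ℝ} (hε : ε ≤ 0) : ¬ CoerciveTwoShellGapTol ε := by
  intro hT
  obtain ⟨δ₀, hδ₀, hGS⟩ := exists_isGroundState_separated LennardJonesGroundStatesExist_holds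
    LennardJonesMinimalDistance_holds
  obtain ⟨g, hg, hG⟩ := hT (δ₀ / 2) (half_pos hδ₀)
  -- a large ground state with energy per particle `< e* + g/2`
  have hlim : Filter.Tendsto (fun N : ℕ => groundStateEnergy lennardJones 3 N / N) Filter.atTop
      (nhds eStar) := crysEnergyLimit
  have hev : ∀ᶠ N : ℕ in Filter.atTop, groundStateEnergy lennardJones 3 N / N < eStar + g / 2 :=
    hlim.eventually (gt_mem_nhds (by linarith))
  obtain ⟨N, hNlt, hN1⟩ := (hev.and (Filter.eventually_ge_atTop 1)).exists
  have hNr : (0 : ℝ) < N := by exact_mod_cast hN1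
  obtain ⟨y, ⟨hyinj, hyE⟩, hysep⟩ := hGS N
  have hEy : interactionEnergy lennardJones y < (N : ℝ) * (eStar + g / 2) := by
    rw [hyE]
    rw [div_lt_iff₀ hNr] at hNlt
    linarith
  -- perturb generically, keeping `δ₀/2`-separation
  obtain ⟨t, ht0, htτ, -, hdist, hE⟩ := exists_pert_small y hyinj (ε := (N : ℝ) * (g / 2))
    (τ := δ₀ / (2 * (4 : ℝ) ^ N)) (by positivity) (by positivity)
  have hsep : ∀ i j : Fin N, i ≠ j → δ₀ / 2 ≤ dist (pert y t i) (pert y t j) := by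
    intro i j hij
    have h1 := dist_pert_ge y t i j
    have h2 := hysep i j hij
    have h3 : |t| * (4 : ℝ) ^ N ≤ δ₀ / 2 := by
      rw [abs_of_pos ht0]
      have := (lt_div_iff₀ (by positivity : (0 : ℝ) < 2 * (4 : ℝ) ^ N)).1 htτ
      linarith
    linarith
  -- every particle is `ε`-bad
  have hbad : bad ε (pert y t) = N :=
    bad_eq_of_forall ε fun i => not_isTwoShellGood_of_nonpos_of_distinct hε (by norm_num) (hdist i)
  have := hG N (pert y t) hsep
  rw [hbad] at this
  nlinarith

/-- In particular the exact-pattern version (`ε = 0`) of the crux is false, while the crux claims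
the `ε = 1/20` version: the threshold lies in `(0, 1/20]` if the crux is true. [folklore] -/
theorem not_coerciveTwoShellGapTol_zero : ¬ CoerciveTwoShellGapTol 0 :=
  not_coerciveTwoShellGapTol_of_nonpos le_rfl

/-! ## §5 Tightness of the price `g` (certified part) -/

/-- **`g ≤ −e*`** for every admissible `(δ, g)`: one particle is bad and has energy `0`. [folklore] -/
theorem g_le_neg_eStar_of_gapAt {δ g : ℝ} (h : GapAt δ g) : g ≤ -eStar := by
  have h1 := h 1 (fun _ => 0) (fun i j hij => absurd (Subsingleton.elim i j) hij)
  rw [bad_eq_of_le (1 / 20) (N := 1) (by norm_num) (fun _ => 0), interactionEnergy_of_subsingleton]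
    at h1
  push_cast at h1
  linarith

/-- **`g ≤ −1/24 − e*`** for every admissible `(δ, g)` with `δ ≤ 1`: the dimer at distance `1` is
`1`-separated, all-bad (`N = 2 ≤ 18`) and has energy `−1/12`.  Numerically (`e* ≈ −0.7175`) this is
`g ≲ 0.676`, whereas the uncertified optimum is `g_opt ≈ 2e-3` (rattler, module docstring §5);
closing the factor `340` needs `e*` from below. [folklore] -/
theorem g_le_of_gapAt {δ g : ℝ} (hδ : δ ≤ 1) (h : GapAt δ g) : g ≤ -1 / 24 - eStar := by
  have hsep : ∀ i j : Fin 2, i ≠ j → δ ≤ dist (dimer i) (dimer j) := by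
    intro i j hij
    fin_cases i <;> fin_cases j <;> simp_all [dimer, dist_eq_norm]
  have h2 := h 2 dimer hsep
  rw [interactionEnergy_dimer, bad_eq_of_le (1 / 20) (N := 2) (by norm_num) dimer] at h2
  push_cast at h2
  linarith

/-- Consequently any `g` offered by the crux at `δ ≤ 1` lies in `(0, −1/24 − e*]`, a genuine
interval since `e* ≤ −1/24` … in fact `e* < −1/24 − g < −1/24`. [folklore] -/
theorem eStar_lt_of_gapAt {δ g : ℝ} (hδ : δ ≤ 1) (hg : 0 < g) (h : GapAt δ g) : eStar < -1 / 24 := by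
  have := g_le_of_gapAt hδ h
  linarith

/-! ## §6 Strengthenings (see the module docstring; the certified one is §4) -/

/-! ## §7 Line `Sketch` — stub-by-stub (no Lean content to add; recorded for the lead)

* `stub_sepReduction` (M): LANDED (p96828).  Checked the constant: good particles are
  `(19/20)(47/50) = 0.893`-isolated, `(2·(3/2)/0.893 + 1)³ = 82.85 < 83`. ✓
* `stub_periodisation` (M): proposal p97286.  Cross-cell distances `≥ 2 > (√2 + 1/20)·1`, so motif
  goodness in `P.points` transfers to index goodness; `e(P) ≤ 𝓔/N` drops only non-positive terms
  (summable). ✓  Not attackable: it is an implication between two open statements whose proof is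
  bookkeeping.
* `stub_torusSlice` (S): at a `1/20`-bad motif point the sup-set contains `(1/20)² − (1/50)² =
  21/10⁴` (take `ε = 1/20`: `1/50 < 1/20 ≤ 3/20`), it is bounded by `(3/20)²` and contains `0`. ✓
* `stub_torusQMC` (XL, the core): `e* + c·mean_motif sSup{0} ∪ {ε² − (1/50)² : 1/50 < ε ≤ 3/20,
  y ε-bad} ≤ e(P)` for `1/3`-separated periodic `P`.  Attacks: (a) §4's generic perturbation makes
  every point `ε`-bad only for `ε` of the order of the perturbation, and the FLOOR `1/50` makes such
  misfits free — defused by design; (b) §3's pile-up is excluded by the `1/3`-separation of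
  `P.points`; (c) rattler / threshold strain / vacancy / non-Barlow lattices: the capped-quadratic
  price `c(θ² − 1/2500)` is BELOW the flat price at small `θ` and the numerics ratio
  `(e − e*)/θ² ≥ 1.1` (NumericsIdeator1.md) leaves `c ≲ 1` admissible — no kill; (d) the statement
  is STRONGER than the torus two-shell gap (it prices `θ ∈ (1/50, 1/20]` too), so a periodic
  near-minimiser with misfit in `(1/50, 1/20]` at sub-quadratic excess would kill the stub but not
  the crux — none known (relaxed hcp misfit `~1e-3 < 1/50`).  Joint sufficiency: kernel-checked
  (`CoerciveTwoShellGap_of`).  Honest size: `stub_torusQMC` = the crux on the torus with a finer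
  price; nothing in the tree bounds `e*` from below to the `1e-3·|e*|` a proof OR a disproof needs.
-/

/-! ## §8 What a refutation must certify -/

/-- **A counterexample is a near-minimiser with dense badness**: if `x` (injective) violates the
price `g`, then `0 ≤ 𝓔(x) − N·e* < g·#bad(x) ≤ g·N`.  Certifying such an `x` in Lean requires
`e*` FROM BELOW to precision `g·#bad/N`, i.e. a Kepler-type lower bound on ALL periodic
Lennard-Jones energies (for a physical witness: to `~1e-3·|e*|`).  The tree has none beyond
stability constants (`KeplerBound` is open), which is why this crux resists disproof exactly as it
resists proof. [folklore] -/
theorem violation_squeeze {g : ℝ} {N : ℕ} {x : Fin N → E3} (hx : Function.Injective x)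
    (hlt : interactionEnergy lennardJones x < (N : ℝ) * eStar + g * (bad (1 / 20) x : ℝ)) :
    0 ≤ interactionEnergy lennardJones x - (N : ℝ) * eStar ∧
      interactionEnergy lennardJones x - (N : ℝ) * eStar < g * (bad (1 / 20) x : ℝ) ∧
      (bad (1 / 20) x : ℝ) ≤ N :=
  ⟨by linarith [card_mul_eStar_le hx], by linarith, by exact_mod_cast bad_le _ x⟩

/-- **Refutation shape**: `¬ crux` iff some `δ > 0` admits, for EVERY `g > 0`, a `δ`-separated
violator (whose excess is then squeezed as above). [folklore] -/
theorem not_coerciveTwoShellGap_iff :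
    ¬ CoerciveTwoShellGap ↔ ∃ δ : ℝ, 0 < δ ∧ ∀ g : ℝ, 0 < g → ∃ (N : ℕ) (x : Fin N → E3),
      (∀ i j : Fin N, i ≠ j → δ ≤ dist (x i) (x j)) ∧
        interactionEnergy lennardJones x < (N : ℝ) * eStar + g * (bad (1 / 20) x : ℝ) := by
  rw [coerciveTwoShellGap_iff]
  push Not
  simp only [GapAt, not_forall, not_le, exists_prop]

end Summit.AtomisticToContinuum.Crystallization.Cruxes.CoerciveTwoShellGap.Disproof

end
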